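import Summits.KontsevichZagierPeriods.KontsevichZagierPeriods.Theorems.LinRedNormalFormArrangementNormalFormStubRebaseSimpleZeroManyChainJanusCells

/-!
# Stub `stub_rebaseSimpleZeroMany`, part `rebaseSimpleZeroMany_common` (crux `ArrangementNormalForm`,
line `janus-bands`) — brick `ChainSubJanus`

**Sub-section Janus for a clean chain** `A < t₀ < ⋯ < tₙ < B` of `n + 1` fibres over a
one-dimensional base with constant letters, by a constant section `T₀ ≤ A ≤ B` (rules 1a + 2).
Writing `1_{A < tᵣ} = 1_{T₀ < tᵣ} − 1_{T₀ < tᵣ ≤ A}` and cutting by the position of `A` among the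
fibres above `r`, the Janus cells (brick `ChainJanusCells`) satisfy, modulo `KZ.relations`,
`[jDom c r r] = [jDom c (n+1) r] − Σ_{r < r' ≤ n+1} [jDom (c ∪ {r'−1}) r' r']`
(`RebaseChain.good_jDom_rec`, downward induction on `r`); the cells `jDom c (n + 1) r` have one
pivot per block and are good (`RebaseChain.good_jDom_top`). All cells live in the box
`{T₀ < tₗ < B}`; the only analytic input is the absolute convergence of the literal integrand
(`n₁ = 0 ∨ n₂ = 0`) on that box. Result: `RebaseChain.good_subJanus`.
Registered: `rebaseSimpleZeroMany_subJanus`.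

References: M. Kontsevich, D. Zagier, *Periods* (2001), §1.2, rules (1a), (2).
-/

noncomputable section

open Set MeasureTheory MvPolynomial
open Literature.NumberTheory.Transcendental Literature.ModelTheory.ExponentialFields

namespace Summit.KontsevichZagierPeriods.ArrangementNormalForm.JanusBands

namespace RebaseChain

open SeparatePos RebasePos RebaseZero RebaseNest

variable {n m' : ℕ} {M : Fin m' → Cf} {T₀ A Bd : Cf}

/-! ### Goodness of the Janus cells -/

section Good

variable {T : BData} {p : MvPolynomial (Fin 0) ℚ} {a : Fin (n + 1) → Option Cf}
  (hTA : ∀ y ∈ cell M, ev T₀ y ≤ ev A y) (hAB : ∀ y ∈ cell M, ev A y ≤ ev Bd y)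
  (hW : IntegrableOn (glitB T p a) (pDom M (fun _ : Fin (n + 1) => T₀) fun _ => Bd))

/-- The representation on the box `{T₀ < tₗ < B}` with the literal integrand (it converges by
hypothesis). -/
def boxRep (M : Fin m' → Cf) (T₀ Bd : Cf) (T : BData) (p : MvPolynomial (Fin 0) ℚ)
    (a : Fin (n + 1) → Option Cf)
    (hW : IntegrableOn (glitB T p a) (pDom M (fun _ : Fin (n + 1) => T₀) fun _ => Bd)) :
    KZ.IntegralRep (0 + 1 + (n + 1)) :=
  ⟨pDom M (fun _ => T₀) (fun _ => Bd), glitB T p a, isSemialgebraic_pDom _ _ _,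
    isSemialgebraicFunOn_glit (isSemialgebraic_pDom _ _ _) _ _ _ _ _ _ _ _, hW⟩

/-- The representation on a Janus cell: the restriction of the box representation. -/
def jRep (c : Finset ℕ) (rU rV : ℕ) : KZ.IntegralRep (0 + 1 + (n + 1)) :=
  (boxRep M T₀ Bd T p a hW).restrict (jDom M c T₀ A Bd rU rV) (isSemialgebraic_gDom _ _ _ _)
    (jDom_subset_box hTA hAB c rU rV)

/-- **The unpinched cells are good**: in `jDom c (n + 1) r` (all cuts below `r`, the link below
`r` cut) the blocks below the fibre `r` have the single pivot `A`, the block from `r` on the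
single pivot `B` (`RebaseChain.good_bdom`). -/
theorem good_jDom_top (hT0 : T₀.1 (Fin.last 0) = 0) (h12 : T.n₁ = 0 ∨ T.n₂ = 0)
    (ha0 : ∀ l d, a l = some d → d.1 (Fin.last 0) = 0)
    (hbox : Bornology.IsBounded (pDom M (fun _ : Fin (n + 1) => T₀) fun _ => Bd)) {c : Finset ℕ} {r : ℕ}
    (hcr : ∀ j : Fin n, (j : ℕ) + 1 = r → (j : ℕ) ∈ c) :
    Good (n + 1) (KZ.of (jRep hTA hAB hW c (n + 1) r)) := by
  classical
  refine good_bdom (s := jRep hTA hAB hW c (n + 1) r) (M := M) (T := T) (p := p) (a := a) c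
    (jU T₀ A (n + 1)) (jV A Bd r) h12 (hbox.subset (jDom_subset_box hTA hAB c (n + 1) r)) rfl
    (fun _ _ => rfl) ha0 (fun l => if (l : ℕ) < r then A else Bd) (fun j hj => ?_) (fun l => ?_)
    fun l => ?_
  · by_cases h1 : ((j.succ : Fin (n + 1)) : ℕ) < r
    · rw [if_pos h1, if_pos (show ((j.castSucc : Fin (n + 1)) : ℕ) < r by
        rw [Fin.val_castSucc]; rw [Fin.val_succ] at h1; omega)]
    · by_cases h2 : ((j.castSucc : Fin (n + 1)) : ℕ) < r
      · exact absurd (hcr j (by rw [Fin.val_castSucc] at h2; rw [Fin.val_succ] at h1; omega)) hj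
      · rw [if_neg h1, if_neg h2]
  · exact Or.inr (by rw [jU_of_lt l.isLt]; exact hT0)
  · left
    by_cases h : (l : ℕ) < r
    · rw [jV_of_lt h, if_pos h]
    · rw [jV_of_le (not_lt.1 h), if_neg h]

/-- **The recursion** (downward induction on the threshold `r`, i.e. induction on
`d = n + 1 − r`): the pinched cell `jDom c r r` is good, because modulo `KZ.relations`
`[jDom c r r] = [jDom c (n + 1) r] − Σ_{r < r' ≤ n + 1} [jDom (c ∪ {r' − 1}) r' r']` (rule 1a: the
position cells are disjoint and cover up to the null ties `tₗ = A`), the unpinched cell is good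
(`good_jDom_top`) and the deeper cells are good by induction. -/
theorem good_jDom_rec (hT0 : T₀.1 (Fin.last 0) = 0) (h12 : T.n₁ = 0 ∨ T.n₂ = 0)
    (ha0 : ∀ l d, a l = some d → d.1 (Fin.last 0) = 0)
    (hbox : Bornology.IsBounded (pDom M (fun _ : Fin (n + 1) => T₀) fun _ => Bd)) : ∀ (d r : ℕ) (c : Finset ℕ), r + d = n + 1 → (∀ j ∈ c, j < r) →
    (∀ j : Fin n, (j : ℕ) + 1 = r → (j : ℕ) ∈ c) →
    Good (n + 1) (KZ.of (jRep hTA hAB hW c r r)) := by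
  classical
  intro d
  induction d using Nat.strong_induction_on with
  | _ d ih =>
  intro r c hd hc hcr
  rcases Nat.eq_zero_or_pos d with rfl | hdpos
  · rw [Nat.add_zero] at hd
    subst hd
    exact good_jDom_top hTA hAB hW hT0 h12 ha0 hbox hcr
  have hr : r < n + 1 := by omega
  -- the pieces of the unpinched cell
  set top := jRep hTA hAB hW c (n + 1) r with htop
  set R : ℕ → KZ.IntegralRep (0 + 1 + (n + 1)) := fun r' =>
    if r' = r then jRep hTA hAB hW c r r else jRep hTA hAB hW (insert (r' - 1) c) r' r' with hR
  have hRr : R r = jRep hTA hAB hW c r r := by simp only [hR, if_pos rfl]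
  have hRne : ∀ {r'}, r' ≠ r → R r' = jRep hTA hAB hW (insert (r' - 1) c) r' r' := fun h => by
    simp only [hR, if_neg h]
  have hsub : ∀ r' ∈ Finset.Icc r (n + 1), (R r').domain ⊆ top.domain := by
    intro r' hr' z hz
    rw [Finset.mem_Icc] at hr'
    by_cases h : r' = r
    · subst h
      rw [hRr] at hz
      exact ((mem_jDom_iff hTA hr hc hcr z).1 hz).1
    · rw [hRne h] at hz
      exact piece_subset_top hAB hr hc (lt_of_le_of_ne hr'.1 (Ne.symm h)) hz
  -- rule (1a)
  have hrel : KZ.of top - ∑ r' ∈ Finset.Icc r (n + 1), KZ.of (R r') ∈ KZ.relations := by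
    refine KZ.of_sub_sum_of_mem_relations (Finset.Icc r (n + 1)) top R (fun r' hr' => ?_)
      (fun r' _ z _ => ?_) (measure_mono_null (fun z hz => ?_)
        (measure_iUnion_null fun l : Fin (n + 1) => volume_tv_eq_ev l A)) (fun r' hr' r'' hr'' hne => ?_)
    · rw [sdiff_eq_empty.2 (hsub r' hr'), measure_empty]
    · by_cases h : r' = r
      · subst h; rw [hRr]; rfl
      · rw [hRne h]; rfl
    · obtain ⟨hz, hzU⟩ := hz
      rw [mem_iUnion]
      by_contra hne
      push Not at hne
      have hne' : ∀ l, tv z l ≠ ev A (yv z) := fun l h => hne l h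
      rcases mem_cover hTA hr hc hcr hz hne' with h | ⟨r', hrr', hr'n, h⟩
      · exact hzU (mem_iUnion₂.2 ⟨r, Finset.mem_Icc.2 ⟨le_rfl, hr.le⟩, by rw [hRr]; exact h⟩)
      · exact hzU (mem_iUnion₂.2 ⟨r', Finset.mem_Icc.2 ⟨hrr'.le, hr'n⟩,
          by rw [hRne (Nat.ne_of_gt hrr')]; exact h⟩)
    · have key : ∀ r' ∈ (Finset.Icc r (n + 1) : Set ℕ), ∀ r'' ∈ (Finset.Icc r (n + 1) : Set ℕ),
          r' < r'' → (R r').domain ∩ (R r'').domain = ∅ := by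
        intro r' hr' r'' hr'' hlt
        rw [Finset.mem_coe, Finset.mem_Icc] at hr' hr''
        refine eq_empty_of_forall_notMem fun z ⟨hz', hz''⟩ => ?_
        have h'' : r'' ≠ r := by omega
        rw [hRne h''] at hz''
        by_cases h' : r' = r
        · subst h'
          rw [hRr] at hz'
          exact not_mem_piece_of_mem hTA hr hc hcr hz' hlt hr''.2 hz''
        · rw [hRne h'] at hz'
          exact not_mem_piece_piece hTA hc (lt_of_le_of_ne hr'.1 (Ne.symm h')) hlt hr''.2 hz' hz''
      show volume ((R r').domain ∩ (R r'').domain) = 0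
      rcases lt_or_gt_of_ne hne with hlt | hgt
      · rw [key r' hr' r'' hr'' hlt, measure_empty]
      · rw [inter_comm, key r'' hr'' r' hr' hgt, measure_empty]
  -- solve for the pinched cell
  rw [← Finset.add_sum_Ioc_eq_sum_Icc (show r ≤ n + 1 from hr.le), hRr] at hrel
  have key : KZ.of (jRep hTA hAB hW c r r) -
      (KZ.of top - ∑ r' ∈ Finset.Ioc r (n + 1), KZ.of (R r')) ∈ KZ.relations := by
    have := KZ.relations.neg_mem hrel
    convert this using 1
    abel
  refine RebaseZero.good_of_sub_mem key ((good_jDom_top hTA hAB hW hT0 h12 ha0 hbox hcr).sub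
    (RebaseNest.good_sum _ _ fun r' hr' => ?_))
  rw [Finset.mem_Ioc] at hr'
  rw [hRne (Nat.ne_of_gt hr'.1)]
  refine ih (n + 1 - r') (by omega) r' _ (by omega) (fun j hj => ?_) (fun j hj => ?_)
  · rcases Finset.mem_insert.1 hj with h | h
    · omega
    · exact (hc j h).trans hr'.1
  · rw [← hj, Nat.add_sub_cancel]
    exact Finset.mem_insert_self _ _

/-- **Sub-section Janus for a clean chain.** A clean chain `A < t₀ < ⋯ < tₙ < B` with constant
letters over a base cell on which `T₀ ≤ A ≤ B` (`T₀` constant), whose literal integrand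
(`n₁ = 0 ∨ n₂ = 0`) converges absolutely on the bounded box `{T₀ < tₗ < B}`, is good for
`GG 0 2 (n + 1)`. [Kontsevich–Zagier 2001, §1.2, rules (1), (2)] -/
theorem good_subJanus (hTA : ∀ y ∈ cell M, ev T₀ y ≤ ev A y) (hAB : ∀ y ∈ cell M, ev A y ≤ ev Bd y)
    (hW : IntegrableOn (glitB T p a) (pDom M (fun _ : Fin (n + 1) => T₀) fun _ => Bd))
    (hT0 : T₀.1 (Fin.last 0) = 0) (h12 : T.n₁ = 0 ∨ T.n₂ = 0)
    (ha0 : ∀ l d, a l = some d → d.1 (Fin.last 0) = 0)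
    (hbox : Bornology.IsBounded (pDom M (fun _ : Fin (n + 1) => T₀) fun _ => Bd))
    {s : KZ.IntegralRep (0 + 1 + (n + 1))} (hdom : s.domain = gDom 0 (n + 1) m' M (clo A) (chi Bd))
    (hint : EqOn s.integrand (glitB T p a) s.domain) : Good (n + 1) (KZ.of s) := by
  have e₀ : KZ.of s - KZ.of (jRep hTA hAB hW ∅ 0 0) ∈ KZ.relations :=
    KZ.of_sub_of_mem_relations_of_eqOn (by rw [hdom, chain_eq_jDom]; rfl) hint
  exact RebaseZero.good_of_sub_mem e₀ (good_jDom_rec hTA hAB hW hT0 h12 ha0 hbox (n + 1) 0 ∅ (zero_add _)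
    (fun j hj => absurd hj (Finset.notMem_empty j)) fun j hj => absurd hj (Nat.succ_ne_zero _))

end Good

end RebaseChain

/-- Registered support goal of this file (part of `rebaseSimpleZeroMany_common`): the sub-section
Janus of a clean chain of `n + 1` fibres over a one-dimensional base (`RebaseChain.good_subJanus`). -/
theorem rebaseSimpleZeroMany_subJanus (n m' : ℕ) (M : Fin m' → (Fin (0 + 1) → ℚ) × ℚ) (T₀ A Bd : (Fin (0 + 1) → ℚ) × ℚ) (T : RebaseZero.BData) (p : MvPolynomial (Fin 0) ℚ) (a : Fin (n + 1) → Option ((Fin (0 + 1) → ℚ) × ℚ)) (hT0 : T₀.1 (Fin.last 0) = 0) (h12 : T.n₁ = 0 ∨ T.n₂ = 0) (ha0 : ∀ l d, a l = some d → d.1 (Fin.last 0) = 0) (hTA : ∀ y ∈ RebaseZero.cell M, RebaseZero.ev T₀ y ≤ RebaseZero.ev A y) (hAB : ∀ y ∈ RebaseZero.cell M, RebaseZero.ev A y ≤ RebaseZero.ev Bd y) (hW : IntegrableOn (RebaseZero.glitB T p a) (RebaseZero.pDom M (fun _ : Fin (n + 1) => T₀) fun _ => Bd)) (hbox : Bornology.IsBounded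 (RebaseZero.pDom M (fun _ : Fin (n + 1) => T₀) fun _ => Bd)) (s : KZ.IntegralRep (0 + 1 + (n + 1))) (hdom : s.domain = SeparatePos.gDom 0 (n + 1) m' M (RebaseChain.clo A) (RebaseChain.chi Bd)) (hint : EqOn s.integrand (RebaseZero.glitB T p a) s.domain) : RebaseZero.Good (n + 1) (KZ.of s) :=
  RebaseChain.good_subJanus hTA hAB hW hT0 h12 ha0 hbox hdom hint

end Summit.KontsevichZagierPeriods.ArrangementNormalForm.JanusBands
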